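/-
# Solo-blind programme on Kontsevich–Zagier, s16: the nilpotent Lie-algebra certificate behind
# "the three rules prove no Euler-type formula for ζ(3)"

Context (paper level, not formalised here).  For `0 < |λ| < 1` the KZ representation
`((0,1)³, λ/(1 − λxyz))` has value `Li₃(λ)`; its cubical symbol realises the rank-4 mixed Tate
structure `P_λ = H³(𝔸³ ∖ {xyz = 1/λ}, faces)` with graded pieces `ℚ(0), ℚ(-1), ℚ(-2), ℚ(-3)`, whose
period matrix in a `W`-adapted rational basis is the classical (unipotent, upper triangular)
polylogarithm matrix.  For a mixed Tate structure the Deligne splitting cocharacter lies in the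
Mumford–Tate group (Green–Griffiths–Kerr, *Mumford–Tate groups and domains*, Thm. I.C.6), so
`Lie(MT) ⊗ ℂ` contains `X = Ad(Π) Y`, `Y = diag(0,1,2,3)`, `Π` the normalised period matrix; since
`Lie(MT)` is defined over `ℚ`, the rational coefficient matrices of `X` along a `ℚ`-basis of the
span of its (transcendental) entries lie in `Lie(MT)` separately, and so do their brackets.

At `λ = 1/2` the three consecutive Kummer classes of `Π` are all `-c`, `c = log 2/(2πi)`, the
degree-2 data are rational (`1/48` and `0`: Euler's `Li₂(1/2) = π²/12 − log²2/2`, which IS an identity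
of KZ classes, `SoloBlindDilogEuler`), and the degree-3 datum is `z − c/48 − c³/6` with
`z = −(7/8)ζ(3)/(2πi)³` (Landen).  THIS FILE checks, over an arbitrary field of characteristic zero
and with `c`, `z` (indeed all structure constants) as free parameters, every finite-dimensional
identity the argument uses:

* `expNil_logPiG`, `PiG_mul_PiGinv`: the unipotent matrix `Π(c; a, a'; b)` with consecutive classes
  `-c`, degree-2 data `c²/2 + a`, `c²/2 + a'` and corner `-c³/6 + b` is `exp` of the explicit
  nilpotent `log Π = -c N₁ + a E₀₂ + a' E₁₃ + (b + c(a+a')/2) E₀₃`, and its inverse is explicit;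
* `Ad_PiG_Y`, `XG_eq_BCH`: `Π Y Π⁻¹ = Y + n₁ + 2 n₂ + 3 n₃ + ½ [n₁, n₂]` equals the explicit matrix
  `XG = (Y + 2a E₀₂ + 2a' E₁₃) − c (N₁ − (2a + a') E₀₃) + 3b E₀₃` (`XG_decomp`);
* `XG_decomp_dependent`, `bracket_dependent`: if the corner datum is `b = ρ c + σ` (the only way
  `{1, c, b}` can be `ℚ`-dependent when `c ∉ ℚ`), then `XG = A − c B` with RATIONAL
  `A = Y + 2aE₀₂ + 2a'E₁₃ + 3σE₀₃`, `B = N₁ − (2a + a' + 3ρ)E₀₃`, and `[A, B] + B = 6(a + ρ) E₀₃` —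
  so `E₀₃ ∈ Lie(MT)` unless `a + ρ = 0`, while in the independent case `E₀₃` is itself a
  coefficient matrix; `bracket_degenerate`: when `a + ρ = 0` the pair closes up (`[A, B] = −B`),
  the abelian-by-torus case `MT = 𝔾_m ⋉ 𝔾_a`.  At `λ = 1/2`: `a = 1/48`, `a' = σ = 0`,
  `b = z − c/48`, so `ρ_here = ρ − 1/48` when `z = ρ c`, and the obstruction `a + ρ_here = ρ = 0`
  is `z = 0`, i.e. `ζ(3) = 0` (`XHalf`, `bracket_half`: `[A, B_ρ] + B_ρ = −6ρ E₀₃` verbatim);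
* `br_Ba_Bb`, `br_br_Ba_Bb_Bb`: the bracket trick for `λ` with `λ, 1 − λ` multiplicatively
  independent: WHATEVER the (unknown) degree ≥ 2 parts of the two rational coefficient matrices
  `B_α = E₀₁ + …`, `B_β = E₁₂ + ρ E₂₃ + …` are, `[[B_α, B_β], B_β] = ρ E₀₃` and
  `[B_α, B_β] = E₀₂ + (q' + pρ) E₀₃`;
* `E03_mulVec_top`: `E₀₃` moves the top basis vector to the bottom one (so `exp(s E₀₃)` shifts the
  period of the top class against the cube by `s·(2πi)³`, which is what makes the twisted
  evaluations algebraically independent).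

What is NOT here: mixed Hodge structures, Mumford–Tate groups, the identification of the cubical
symbol with `P_λ`, or any statement about real numbers; those are the paper-level inputs named
above.  The file is pure matrix algebra over `Field K`, `CharZero K`.
-/
import Mathlib.LinearAlgebra.Matrix.Notation
import Mathlib.Algebra.Lie.OfAssociative
import Mathlib.Tactic.FinCases
import Mathlib.Tactic.Ring
import Mathlib.Tactic.FieldSimp
import Mathlib.Tactic.NormNum
import HarnessLib

namespace Summit.KontsevichZagierPeriods.KontsevichZagierPeriods.Theorems

namespace SoloBlind

namespace PolylogLie

variable {K : Type*} [Field K]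

/-! ## The weight-flag matrices of a rank-4 Hodge–Tate structure -/

section defs

variable (K)

/-- `E₀₂`. -/
def E02 : Matrix (Fin 4) (Fin 4) K := !![0, 0, 1, 0; 0, 0, 0, 0; 0, 0, 0, 0; 0, 0, 0, 0]

/-- `E₁₃`. -/
def E13 : Matrix (Fin 4) (Fin 4) K := !![0, 0, 0, 0; 0, 0, 0, 1; 0, 0, 0, 0; 0, 0, 0, 0]

/-- `E₀₃` — the deepest (drop-3) direction. -/
def E03 : Matrix (Fin 4) (Fin 4) K := !![0, 0, 0, 1; 0, 0, 0, 0; 0, 0, 0, 0; 0, 0, 0, 0]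

/-- `N₁ = E₀₁ + E₁₂ + E₂₃`, the principal nilpotent of drop 1. -/
def N1 : Matrix (Fin 4) (Fin 4) K := !![0, 1, 0, 0; 0, 0, 1, 0; 0, 0, 0, 1; 0, 0, 0, 0]

/-- The grading `Y = diag(0,1,2,3)` (`= p` on `Gr^W_{2p}`). -/
def Y : Matrix (Fin 4) (Fin 4) K := !![0, 0, 0, 0; 0, 1, 0, 0; 0, 0, 2, 0; 0, 0, 0, 3]

end defs

/-- The commutator; it is the Lie bracket of the associative algebra of matrices (`br_eq_lie`). -/
def br (A B : Matrix (Fin 4) (Fin 4) K) : Matrix (Fin 4) (Fin 4) K := A * B - B * A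

/-- `br` is the Lie bracket of the matrix algebra. -/
theorem br_eq_lie (A B : Matrix (Fin 4) (Fin 4) K) : br A B = ⁅A, B⁆ := (Ring.lie_def A B).symm

/-- `N₁² = E₀₂ + E₁₃`. -/
theorem N1_sq : N1 K * N1 K = E02 K + E13 K := by
  ext i j; fin_cases i <;> fin_cases j <;> simp [N1, E02, E13, Matrix.mul_apply, Fin.sum_univ_four]

/-- `N₁³ = E₀₃`. -/
theorem N1_cube : N1 K * N1 K * N1 K = E03 K := by
  ext i j; fin_cases i <;> fin_cases j <;> simp [N1, E03, Matrix.mul_apply, Fin.sum_univ_four]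

/-- `N₁⁴ = 0`. -/
theorem N1_pow_four : N1 K * N1 K * N1 K * N1 K = 0 := by
  ext i j; fin_cases i <;> fin_cases j <;> simp [N1, Matrix.mul_apply, Fin.sum_univ_four]

/-- `[Y, N₁] = −N₁` (drop 1). -/
theorem br_Y_N1 : br (Y K) (N1 K) = -N1 K := by
  ext i j; fin_cases i <;> fin_cases j <;>
    simp [br, Y, N1] <;> norm_num

/-- `[Y, E₀₃] = −3 E₀₃` (drop 3). -/
theorem br_Y_E03 : br (Y K) (E03 K) = -(3 : K) • E03 K := by
  ext i j; fin_cases i <;> fin_cases j <;>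
    simp [br, Y, E03]

/-- `[E₀₂, N₁] = E₀₃`. -/
theorem br_E02_N1 : br (E02 K) (N1 K) = E03 K := by
  ext i j; fin_cases i <;> fin_cases j <;> simp [br, E02, N1, E03]

/-- `[E₁₃, N₁] = −E₀₃`. -/
theorem br_E13_N1 : br (E13 K) (N1 K) = -E03 K := by
  ext i j; fin_cases i <;> fin_cases j <;> simp [br, E13, N1, E03]

/-- `E₀₃` sends the top flag vector `e₃` to `e₀` (and kills `e₀, e₁, e₂`). -/
theorem E03_mulVec_top : (E03 K).mulVec ![0, 0, 0, 1] = ![1, 0, 0, 0] := by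
  ext i; fin_cases i <;> simp [E03, Matrix.mulVec, dotProduct, Fin.sum_univ_four]

/-! ## The general unipotent period matrix with equal consecutive classes, its logarithm,
its inverse, and `Ad(Π) Y` -/

/-- `Π(c; a, a'; b)`: consecutive classes `-c`, degree-2 entries `c²/2 + a`, `c²/2 + a'`,
corner `-c³/6 + b`.  (`λ = 1/2`: `c = log 2/(2πi)`, `a = 1/48`, `a' = 0`, `b = z − c/48`.) -/
def PiG (c a a' b : K) : Matrix (Fin 4) (Fin 4) K :=
  !![1, -c, c ^ 2 / 2 + a, -c ^ 3 / 6 + b; 0, 1, -c, c ^ 2 / 2 + a'; 0, 0, 1, -c; 0, 0, 0, 1]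

/-- `log Π = -c N₁ + a E₀₂ + a' E₁₃ + (b + c (a + a')/2) E₀₃`. -/
def logPiG (c a a' b : K) : Matrix (Fin 4) (Fin 4) K :=
  !![0, -c, a, b + c * (a + a') / 2; 0, 0, -c, a'; 0, 0, 0, -c; 0, 0, 0, 0]

/-- The inverse `Π⁻¹` (= `exp(-log Π)`). -/
def PiGinv (c a a' b : K) : Matrix (Fin 4) (Fin 4) K :=
  !![1, c, c ^ 2 / 2 - a, c ^ 3 / 6 - b - c * (a + a'); 0, 1, c, c ^ 2 / 2 - a'; 0, 0, 1, c; 0, 0, 0, 1]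

/-- The exponential of a `4 × 4` matrix with vanishing fourth power. -/
def expNil (M : Matrix (Fin 4) (Fin 4) K) : Matrix (Fin 4) (Fin 4) K :=
  1 + M + (1 / 2 : K) • (M * M) + (1 / 6 : K) • (M * M * M)

/-- The drop-`k` components of `log Π`. -/
def n1 (c : K) : Matrix (Fin 4) (Fin 4) K := -c • N1 K
/-- The drop-2 component of `log Π`. -/
def n2 (a a' : K) : Matrix (Fin 4) (Fin 4) K := a • E02 K + a' • E13 K
/-- The drop-3 component of `log Π`. -/
def n3 (t : K) : Matrix (Fin 4) (Fin 4) K := t • E03 K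

/-- `log Π = n₁ + n₂ + n₃`. -/
theorem logPiG_eq (c a a' b : K) :
    logPiG c a a' b = n1 c + n2 a a' + n3 (b + c * (a + a') / 2) := by
  ext i j; fin_cases i <;> fin_cases j <;> simp [logPiG, n1, n2, n3, N1, E02, E13, E03]

/-- `(log Π)⁴ = 0`. -/
theorem logPiG_pow_four (c a a' b : K) :
    logPiG c a a' b * logPiG c a a' b * logPiG c a a' b * logPiG c a a' b = 0 := by
  ext i j; fin_cases i <;> fin_cases j <;> simp [logPiG, Matrix.mul_apply, Fin.sum_univ_four]

/-- `X = Ad(Π) Y`, explicitly. -/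
def XG (c a a' b : K) : Matrix (Fin 4) (Fin 4) K :=
  !![0, -c, 2 * a, 3 * b + c * (2 * a + a'); 0, 1, -c, 2 * a'; 0, 0, 2, -c; 0, 0, 0, 3]

/-! ## Decomposition of `X` along `{1, c, b}` and the brackets -/

/-- `A(a, a'; σ) = Y + 2a E₀₂ + 2a' E₁₃ + 3σ E₀₃` (rational when `a, a', σ` are). -/
def Arat (a a' σ : K) : Matrix (Fin 4) (Fin 4) K :=
  !![0, 0, 2 * a, 3 * σ; 0, 1, 0, 2 * a'; 0, 0, 2, 0; 0, 0, 0, 3]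

/-- `B(τ) = N₁ − τ E₀₃`. -/
def Brat (τ : K) : Matrix (Fin 4) (Fin 4) K := !![0, 1, 0, -τ; 0, 0, 1, 0; 0, 0, 0, 1; 0, 0, 0, 0]

/-- Independent case: `X = A(a,a';0) − c·B(2a + a') + 3b·E₀₃` — the coefficient matrices of
`1, c, b`. -/
theorem XG_decomp (c a a' b : K) :
    XG c a a' b = Arat a a' 0 - c • Brat (2 * a + a') + (3 * b) • E03 K := by
  ext i j; fin_cases i <;> fin_cases j <;> simp [XG, Arat, Brat, E03]
  all_goals ring

/-- Dependent case `b = ρ c + σ`: `X = A(a,a';σ) − c·B(2a + a' + 3ρ)`. -/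
theorem XG_decomp_dependent (c a a' ρ σ : K) :
    XG c a a' (ρ * c + σ) = Arat a a' σ - c • Brat (2 * a + a' + 3 * ρ) := by
  ext i j; fin_cases i <;> fin_cases j <;> simp [XG, Arat, Brat]
  all_goals ring

/-- The general bracket: `[A(a,a';σ), B(τ)] + B(τ) = (2τ + 2a − 2a') E₀₃`. -/
theorem bracket_general (a a' σ τ : K) :
    br (Arat a a' σ) (Brat τ) + Brat τ = (2 * τ + 2 * a - 2 * a') • E03 K := by
  ext i j; fin_cases i <;> fin_cases j <;>
    simp [br, Arat, Brat, E03] <;> ring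

/-- Dependent case: `[A, B] + B = 6(a + ρ) E₀₃`; hence `E₀₃ ∈ Lie(MT)` unless `a + ρ = 0`. -/
theorem bracket_dependent (a a' ρ σ : K) :
    br (Arat a a' σ) (Brat (2 * a + a' + 3 * ρ)) + Brat (2 * a + a' + 3 * ρ)
      = (6 * (a + ρ)) • E03 K := by
  rw [bracket_general]; congr 1; ring

/-- Degenerate case `a + ρ = 0` (`τ = a' − a`): the two coefficient matrices close up,
`[A, B] = −B` — the Lie algebra of `𝔾_m ⋉ 𝔾_a`. -/
theorem bracket_degenerate (a a' σ : K) :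
    br (Arat a a' σ) (Brat (a' - a)) = -Brat (a' - a) := by
  have h := bracket_general (K := K) a a' σ (a' - a)
  have h0 : (2 * (a' - a) + 2 * a - 2 * a' : K) = 0 := by ring
  rw [h0, zero_smul] at h
  exact eq_neg_of_add_eq_zero_left h

/-! ## `λ = 1/2`: `a = 1/48`, `a' = 0`, `b = z − c/48` -/

/-- The normalised period matrix of `P_{1/2}`: `Π = exp(−c N₁) + (1/48) E₀₂ + (z − c/48) E₀₃`. -/
def PiHalf (c z : K) : Matrix (Fin 4) (Fin 4) K := PiG c (1 / 48) 0 (z - c / 48)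

/-! ## The bracket trick (`λ`, `1 − λ` multiplicatively independent) -/

/-- `B_α = E₀₁ +` an arbitrary element of drop ≥ 2. -/
def Ba (p q r : K) : Matrix (Fin 4) (Fin 4) K := !![0, 1, p, r; 0, 0, 0, q; 0, 0, 0, 0; 0, 0, 0, 0]

/-- `B_β = E₁₂ + ρ E₂₃ +` an arbitrary element of drop ≥ 2. -/
def Bb (ρ p' q' r' : K) : Matrix (Fin 4) (Fin 4) K :=
  !![0, 0, p', r'; 0, 0, 1, q'; 0, 0, 0, ρ; 0, 0, 0, 0]

/-- `[B_α, B_β] = E₀₂ + (q' + pρ) E₀₃`. -/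
theorem br_Ba_Bb (p q r ρ p' q' r' : K) :
    br (Ba p q r) (Bb ρ p' q' r') = E02 K + (q' + p * ρ) • E03 K := by
  ext i j; fin_cases i <;> fin_cases j <;>
    simp [br, Ba, Bb, E02, E03]

/-- `[[B_α, B_β], B_β] = ρ E₀₃`, independently of the unknown drop ≥ 2 parts. -/
theorem br_br_Ba_Bb_Bb (p q r ρ p' q' r' : K) :
    br (br (Ba p q r) (Bb ρ p' q' r')) (Bb ρ p' q' r') = ρ • E03 K := by
  rw [br_Ba_Bb]
  ext i j; fin_cases i <;> fin_cases j <;>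
    simp [br, Bb, E02, E03]

/-- Rank 3 (`P_λ^{(2)}`, value `Li₂ λ`): `[E₀₁ + pE₀₂, E₁₂ + p'E₀₂] = E₀₂`. -/
theorem br_trick_rank_three (p p' : K) :
    !![0, 1, p; 0, 0, 0; 0, 0, 0] * !![0, 0, p'; 0, 0, 1; 0, 0, 0]
      - !![0, 0, p'; 0, 0, 1; 0, 0, 0] * !![0, 1, p; 0, 0, 0; 0, 0, 0]
      = (!![0, 0, 1; 0, 0, 0; 0, 0, 0] : Matrix (Fin 3) (Fin 3) K) := by
  ext i j; fin_cases i <;> fin_cases j <;> simp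

/-! ## Identities that use characteristic zero (rational structure constants `1/2`, `1/6`, `1/48`) -/

section charZero

variable [CharZero K]

/-- `exp (log Π) = Π`. -/
theorem expNil_logPiG (c a a' b : K) : expNil (logPiG c a a' b) = PiG c a a' b := by
  ext i j; fin_cases i <;> fin_cases j <;>
    simp [expNil, logPiG, PiG] <;> ring

/-- `exp (-log Π) = Π⁻¹` (the explicit inverse). -/
theorem expNil_neg_logPiG (c a a' b : K) : expNil (-logPiG c a a' b) = PiGinv c a a' b := by
  ext i j; fin_cases i <;> fin_cases j <;>
    simp [expNil, logPiG, PiGinv] <;> ring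

/-- `Π Π⁻¹ = 1`. -/
theorem PiG_mul_PiGinv (c a a' b : K) : PiG c a a' b * PiGinv c a a' b = 1 := by
  ext i j; fin_cases i <;> fin_cases j <;>
    simp [PiG, PiGinv, Matrix.mul_apply, Fin.sum_univ_four] <;> ring

/-- `Π⁻¹ Π = 1`. -/
theorem PiGinv_mul_PiG (c a a' b : K) : PiGinv c a a' b * PiG c a a' b = 1 := by
  ext i j; fin_cases i <;> fin_cases j <;>
    simp [PiG, PiGinv, Matrix.mul_apply, Fin.sum_univ_four] <;> ring

/-- `Π Y Π⁻¹ = X`. -/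
theorem Ad_PiG_Y (c a a' b : K) : PiG c a a' b * Y K * PiGinv c a a' b = XG c a a' b := by
  ext i j; fin_cases i <;> fin_cases j <;>
    simp [PiG, PiGinv, Y, XG, Matrix.mul_apply, Fin.sum_univ_four] <;> ring

/-- The Baker–Campbell–Hausdorff form used in the text:
`Ad(Π) Y = Y + n₁ + 2 n₂ + 3 n₃ + ½ [n₁, n₂]` (brackets of total drop ≥ 4 vanish). -/
theorem XG_eq_BCH (c a a' b : K) :
    XG c a a' b = Y K + n1 c + (2 : K) • n2 a a' + (3 : K) • n3 (b + c * (a + a') / 2)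
      + (1 / 2 : K) • br (n1 c) (n2 a a') := by
  ext i j; fin_cases i <;> fin_cases j <;>
    simp [XG, Y, n1, n2, n3, br, N1, E02, E13, E03]
  all_goals ring

/-- `Π_{1/2} = exp(−cN₁) + (1/48)E₀₂ + (z − c/48)E₀₃`. -/
theorem PiHalf_eq (c z : K) :
    PiHalf c z = expNil (-c • N1 K) + (1 / 48 : K) • E02 K + (z - c / 48) • E03 K := by
  ext i j; fin_cases i <;> fin_cases j <;>
    simp [PiHalf, PiG, expNil, N1, E02, E03] <;> ring

/-- `log Π = −c N₁ + (1/48) E₀₂ + (z − c/96) E₀₃`. -/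
theorem logPiHalf_eq (c z : K) :
    logPiG c (1 / 48) 0 (z - c / 48) = -c • N1 K + (1 / 48 : K) • E02 K + (z - c / 96) • E03 K := by
  ext i j; fin_cases i <;> fin_cases j <;> simp [logPiG, N1, E02, E03]
  all_goals ring

/-- `(⋆)`: `X = (Y + E₀₂/24) − c (N₁ + E₀₃/48) + 3z E₀₃`. -/
theorem XHalf (c z : K) :
    PiHalf c z * Y K * PiGinv c (1 / 48) 0 (z - c / 48)
      = Arat (1 / 48) 0 0 - c • Brat (-1 / 48) + (3 * z) • E03 K := by
  rw [PiHalf, Ad_PiG_Y, XG_decomp]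
  ext i j; fin_cases i <;> fin_cases j <;> simp [Arat, Brat, E03]
  all_goals ring

/-- Case 2 of the text (`z = ρ c`): with `A = Y + E₀₂/24` and `B_ρ = −N₁ + (3ρ − 1/48) E₀₃`,
`X = A + c B_ρ` and `[A, B_ρ] + B_ρ = −6ρ E₀₃`.  Only `ρ ≠ 0`, i.e. `ζ(3) ≠ 0`, is needed to
produce `E₀₃`. -/
theorem XHalf_dependent (c ρ : K) :
    XG c (1 / 48) 0 (ρ * c - c / 48) = Arat (1 / 48) 0 0 + c • (-Brat (3 * ρ - 1 / 48)) := by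
  ext i j; fin_cases i <;> fin_cases j <;> simp [XG, Arat, Brat]
  all_goals ring

/-- `[A, B_ρ] + B_ρ = −6ρ E₀₃` at `λ = 1/2`. -/
theorem bracket_half (ρ : K) :
    br (Arat (1 / 48) 0 0) (-Brat (3 * ρ - 1 / 48)) + -Brat (3 * ρ - 1 / 48)
      = (-6 * ρ) • E03 K := by
  ext i j; fin_cases i <;> fin_cases j <;>
    simp [br, Arat, Brat, E03] <;> ring

end charZero

end PolylogLie

end SoloBlind

end Summit.KontsevichZagierPeriods.KontsevichZagierPeriods.Theorems
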